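import Summits.MatrixMultiplication.OmegaCensus.ThreeSetLineModFourSliceExc
import Summits.MatrixMultiplication.OmegaCensus.ThreeSetLineModFourSliceSound
import Summits.MatrixMultiplication.OmegaCensus.ThreeSetLineNormFilter
import HarnessLib

/-!
# The bit-sliced MOD-4 FILTER, VII: soundness of the block checker with declared exceptions

ω-census `pub-omega`, family (b3), seat pub-omega-group gen 42.  Framing: lottery ticket; floor = certified bounds/negative
ranges.  VALUE: a kernel TOOL for the three-set cube cells `(4, d, e)@p²` (`ThreeSetZpCells4Core`); NOT progress on ω.
**`blockChkX_sound`**: `LineMod.blockChkX … = true` ⇒ no datum of the block `(compsLit n j).map (pre ++ ·)` admits a solution: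
data with a zero survivor bit by `LineMod.dead_of_survMask_testBit`; a declared exception is pinned to its declared datum
(`list_eq_of_getD_le`: same length and sum, entries congruent mod 4 with the declared ones `≤ 3`) and killed by
`LineNorm.normBlockX_sound`.
-/

namespace Summit.MatrixMultiplication.OmegaCensus

/-! # Soundness of the block checker with exceptions -/

namespace LineMod

open Finset

/-- A set bit of `excMask` names a declared exception. [folklore] -/
theorem exists_of_excMask_testBit {k : ℕ} : ∀ exc : List (ℕ × List ℕ), (excMask exc).testBit k = true → ∃ F, (k, F) ∈ exc
  | [], h => by simp [excMask] at h
  | kF :: es, h => by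
    rw [excMask, Nat.testBit_lor, Bool.or_eq_true] at h
    rcases h with h | h
    · obtain ⟨F, hF⟩ := exists_of_excMask_testBit es h
      exact ⟨F, List.mem_cons_of_mem _ hF⟩
    · rw [Nat.testBit_two_pow] at h
      have hk : kF.1 = k := by simpa using h
      exact ⟨kF.2, by rw [← hk]; exact List.mem_cons_self⟩

/-- Two low bits determine a natural number mod 4. [folklore] -/
theorem mod_four_eq_of_testBit {a b : ℕ} (h0 : a.testBit 0 = b.testBit 0) (h1 : a.testBit 1 = b.testBit 1) : a % 4 = b % 4 := by
  rw [Nat.testBit_zero, Nat.testBit_zero] at h0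
  rw [Nat.testBit_succ, Nat.testBit_succ, Nat.testBit_zero, Nat.testBit_zero] at h1
  have e0 : a % 2 = b % 2 := by
    rcases Nat.mod_two_eq_zero_or_one a with ha | ha <;> rcases Nat.mod_two_eq_zero_or_one b with hb | hb <;> simp_all
  have e1 : a / 2 % 2 = b / 2 % 2 := by
    rcases Nat.mod_two_eq_zero_or_one (a / 2) with ha | ha <;> rcases Nat.mod_two_eq_zero_or_one (b / 2) with hb | hb <;> simp_all
  omega

/-- Lists of the same length `p` and the same sum, pointwise `≥`, are equal. [folklore] -/
theorem list_eq_of_getD_le {p : ℕ} {F G : List ℕ} (hF : F.length = p) (hG : G.length = p) (hs : F.sum = G.sum)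
    (hle : ∀ i < p, F.getD i 0 ≤ G.getD i 0) : F = G := by
  have hsum : ∑ i ∈ range p, F.getD i 0 = ∑ i ∈ range p, G.getD i 0 := by
    rw [← hF, ← LineInv.sum_eq_sum_getD, hF, ← hG, ← LineInv.sum_eq_sum_getD, hs]
  have heq : ∀ i ∈ range p, F.getD i 0 = G.getD i 0 := by
    by_contra hne
    push Not at hne
    obtain ⟨i, hi, hne⟩ := hne
    have hlt : F.getD i 0 < G.getD i 0 := lt_of_le_of_ne (hle i (mem_range.1 hi)) hne
    have := sum_lt_sum (fun j hj => hle j (mem_range.1 hj)) ⟨i, hi, hlt⟩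
    omega
  apply List.ext_getElem (by rw [hF, hG])
  intro i h1 h2
  have := heq i (mem_range.2 (by rw [← hF]; exact h1))
  rwa [List.getD_eq_getElem F 0 h1, List.getD_eq_getElem G 0 h2] at this

section Sound

variable {p : ℕ} [NeZero p] [Fact p.Prime]

/-- **Soundness of the block checker with exceptions.**  `blockChkX … = true` ⇒ no datum of the block admits a solution (the
sliced mod-4 filter for all but the declared exceptions, which are pinned to their declared data and killed by the norm filter,
`LineNorm.normBlockX_sound`). [folklore] -/
theorem blockChkX_sound {K d e : ℕ} {W pre : List ℕ} {n j : ℕ} {sched : List Bool} {exc : List (ℕ × List ℕ)}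
    {nB nX nM g gi : ℕ} {dlog : List ℕ} {st : List Bool} {ms : List ℤ} {uexc : List (List ℕ × List (ℕ × ℕ × ℕ × ℕ))}
    (h : blockChkX p K d e W pre n j sched exc nB nX nM g gi dlog st ms uexc = true) :
    ∀ Fl ∈ (ZpZpDomino.compsLit n j).map (pre ++ ·), ∀ (G : ZMod p → ℕ) (s : ZMod p), (∀ u, G u ≤ e) →
      ¬ ∀ τ : ZMod p, (∑ u : ZMod p, lineMat3 (vecFn W) (vecFn Fl) τ u * G u) + (if s = τ then 1 else 0) = K := by
  intro Fl hFl G s hG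
  unfold blockChkX at h
  dsimp only at h
  simp only [Bool.and_eq_true, decide_eq_true_eq, beq_iff_eq] at h
  obtain ⟨⟨⟨⟨⟨⟨⟨⟨⟨_, hp3⟩, hWlen⟩, hlen⟩, hsum⟩, hc⟩, he⟩, hexc⟩, hsm⟩, hnorm⟩ := h
  rw [List.mem_map] at hFl
  obtain ⟨l, hl, rfl⟩ := hFl
  obtain ⟨hllen, hlsum⟩ := length_sum_of_mem_compsLit n j l hl
  obtain ⟨_, hrep⟩ := blockPlanes_spec pre n j
  obtain ⟨k, hk, hbits⟩ := hrep l hl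
  by_cases hsk : (survMask p (onesOf (blockPlanes pre n j).1) K e W (sdigits p (blockPlanes pre n j).2) sched).testBit k = false
  · exact dead_of_survMask_testBit hp3 hWlen hlen hsum hc he hl hk hbits hsk G s
  · -- a declared exception: pin the datum and use the norm filter
    have hek : (excMask exc).testBit k = true := by
      have hb := congrArg (fun x => x.testBit k) hsm
      simp only [Nat.testBit_lor] at hb
      rw [Bool.eq_false_iff.not, not_not] at hsk
      rw [hsk, Bool.true_or] at hb
      exact hb.symm
    obtain ⟨F, hF⟩ := exists_of_excMask_testBit exc hek
    rw [List.all_eq_true] at hexc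
    have hcF := hexc _ hF
    unfold excChk at hcF
    simp only [Bool.and_eq_true, decide_eq_true_eq, beq_iff_eq, List.all_eq_true, List.mem_range] at hcF
    obtain ⟨⟨hFlen, hFsum⟩, hFi⟩ := hcF
    have hFl : pre ++ l = F := by
      symm
      refine list_eq_of_getD_le hFlen (by rw [List.length_append, hllen, hlen]) (by rw [hFsum, List.sum_append, hlsum, hsum]) ?_
      intro i hi
      obtain ⟨⟨hle3, hb0⟩, hb1⟩ := hFi i hi
      have e0 := (hbits i 0 (by norm_num)).symm.trans hb0
      have e1 := (hbits i 1 (by norm_num)).symm.trans hb1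
      have hm := mod_four_eq_of_testBit e0 e1
      omega
    rw [hFl]
    exact LineNorm.normBlockX_sound (p := p) hnorm F (List.mem_map.2 ⟨(k, F), hF, rfl⟩) G s hG

end Sound

end LineMod

end Summit.MatrixMultiplication.OmegaCensus
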